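import Literature.Probability.LatticeModels.PhasesLowerCorrelationsFiniteSqrtExtension
import Literature.MathematicalPhysics.QuantumFieldTheory.ZnWilsonLoopMonotone
import HarnessLib

/-!
# `ℤ_n`-centre domination of Wilson loops for EVERY `n` (Fröhlich 1979 / Grosse 1988 (4.134));
# `SU(N) ⊇ ℤ_N` for every `N`

The tree's `abs_wilsonExpectation_wilsonLoop_le_zn` (`ZnCentreDominatedWilsonLoops.lean`) proves
Fröhlich's comparison `|⟨W_{R×T}⟩_{G,ρ,β,L}| ≤ ⟨W_{R×T}⟩_{ℤ_n, Nβ, L}` (J. Fröhlich, Phys. Lett. 83B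
(1979) 195, title theorem «Confinement in `ℤ_n` lattice gauge theories implies confinement in `SU(n)`
lattice Higgs theories»; printed form H. Grosse, *Models in Statistical Physics and QFT* (1988)
§4.2.4 (4.131)–(4.134)) only for ODD `n`, because its two correlation-inequality inputs — the
Messager–Miracle-Solé–Pfister inequality (phases lower the correlations) and Ginibre's monotonicity —
were typed for configuration groups in which every element is a square; for even `n` the tree falls
back on the central involution (`abs_wilsonExpectation_wilsonLoop_le_centre`, `ℤ₂` comparison).
With both inputs now typed for finite groups through Ginibre's square-root extension
`ℤ_n^E ↪ ℤ_{2n}^E` (`GinibreSqrtExt.abs_phasedGinibreExpect_re_mul_le_of_le_of_sqrtExt`,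
`zn_wilsonExpectation_wilsonLoop_nonneg_of_neZero`), the parity restriction disappears:

* `abs_wilsonExpectation_wilsonLoop_le_zn_of_neZero`: for every `n ≥ 1`, compact second-countable
  `G`, continuous unitary `ρ` on `ℂ^N`, `ι : ℤ_n → Z(G)` with `ρ(ι(z)) = z·1`, `β ≥ 0`, torus
  `(ℤ/Lℤ)^d`: `|⟨W_{R×T}⟩_{G,ρ,β,L}| ≤ ⟨W_{R×T}⟩_{ℤ_n, Nβ, L}`; `hasAreaLaw_of_zn_of_neZero`;
* `specialUnitaryGroup_abs_wilsonExpectation_wilsonLoop_le_zn_of_neZero` (`SU(N)`, fundamental,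
  `ℤ_n ∋ z ↦ z·1` for any `n ∣ N`, `n ≥ 1`), `specialUnitaryGroup_hasAreaLaw_of_zn_of_neZero`, and the
  FULL CENTRE case `suN_abs_wilsonExpectation_wilsonLoop_le_zN` /`suN_hasAreaLaw_of_zN`:
  `|⟨W_{R×T}⟩_{SU(N),β,L}| ≤ ⟨W_{R×T}⟩_{ℤ_N, Nβ, L}` for EVERY `N ≥ 1` (new for even `N`, e.g.
  `su4_abs_wilsonExpectation_wilsonLoop_le_z4`; for `N = 2` this is the `ℤ₂` bound of
  `CentreDominatedWilsonLoops.lean` in the `znRep 2` currency).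

* centre-blind perturbations `F ≥ 0` of the Wilson weight (Fröhlich's lattice-HIGGS setting), every
  `n ≥ 1`: `abs_integral_wilsonLoop_mul_le_of_twistInvariant_zn_of_neZero`,
  `abs_perturbedWilsonLoop_le_zn_of_neZero`, and `suN_abs_perturbedWilsonLoop_le_zN` — the title
  theorem «confinement in `ℤ_N` LGT ⇒ confinement in `SU(N)` lattice Higgs theories» for EVERY `N`
  and every matter weight blind to the centre.

Proof: verbatim the tree's averaged-Haar-invariance argument
(`integral_eq_integral_integral_abelianTwist`, `exp_neg_mul_wilsonAction_abelianTwist`,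
`wilsonLoop_abelianTwist`) with the two inequality inputs replaced by their square-root-extension
versions.

HONEST LABEL: a comparison theorem between finite-volume lattice expectations at every `β ≥ 0`; it
transfers confinement FROM the `ℤ_n` theory (which deconfines at weak coupling in `d = 3, 4`:
Montvay–Münster §3.7 p. 164; tree barriers `ZnHiggsPhaseD4`, `DiscreteSubgroupFreezing`), so it has
content at strong coupling only. Nothing here proves the Yang–Mills mass gap (Clay).

## References

* J. Fröhlich, Phys. Lett. 83B (1979) 195–198. [Frohlich1979ZN]
* H. Grosse, *Models in Statistical Physics and Quantum Field Theory*, Springer 1988, §4.2.4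
  eqs. (4.130)–(4.134). [Grosse1988]
* J. Ginibre, Comm. Math. Phys. 16 (1970) 310–328, §2 Example 4 (discrete case). [Ginibre1970]
* A. Messager, S. Miracle-Solé, C. Pfister, Comm. Math. Phys. 58 (1978) 19–29, Prop. 1.
  [MessagerMiracleSolePfister1978]
* I. Montvay, G. Münster, *Quantum Fields on a Lattice*, CUP 1994, §3.7. [MontvayMunster1994]
-/

noncomputable section

open MeasureTheory Filter Finset
open Literature.Probability.LatticeModels Literature.MathematicalPhysics.QuantumLattice
open Literature.Barriers.QuantumFields (rootsOfUnityCircle mem_rootsOfUnityCircle znRep)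

namespace Literature.MathematicalPhysics.QuantumFieldTheory

/-! ### Helpers -/

section Helpers

variable {d L N : ℕ} {G : Type*} [Group G] [TopologicalSpace G] [IsTopologicalGroup G]
  {Γ : Type*} [CommGroup Γ] [TopologicalSpace Γ] (ι : Γ →* G)

/-- The abelian twist is jointly continuous in `(U, σ)` for continuous `ι`. [folklore] -/
private theorem continuous_abelianTwist_pair (hιc : Continuous ι) :
    Continuous fun p : GaugeConfig d L G × GaugeConfig d L Γ => abelianTwist ι p.2 p.1 :=
  continuous_pi fun e =>
    (hιc.comp ((continuous_apply e).comp continuous_snd)).mul ((continuous_apply e).comp continuous_fst)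

/-- `‖tr U‖ ≤ N` for a unitary `N × N` matrix. [folklore] -/
private theorem norm_trace_le_of_mem_unitaryGroup_aux {U : Matrix (Fin N) (Fin N) ℂ}
    (hU : U ∈ Matrix.unitaryGroup (Fin N) ℂ) : ‖U.trace‖ ≤ N := by
  calc ‖U.trace‖ = ‖∑ a, U a a‖ := rfl
    _ ≤ ∑ a, ‖U a a‖ := norm_sum_le _ _
    _ ≤ ∑ _a : Fin N, (1 : ℝ) := Finset.sum_le_sum fun a _ => entry_norm_bound_of_unitary hU a a
    _ = N := by simp

variable [NeZero L] [CompactSpace G] [MeasurableSpace G] [BorelSpace G] [SecondCountableTopology G]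
  [IsTopologicalGroup Γ] [CompactSpace Γ] [SecondCountableTopology Γ] [MeasurableSpace Γ] [BorelSpace Γ]

/-- Integrability of the inner `σ`-averages as functions of the background `U`. [folklore] -/
private theorem integrable_integral_abelianTwist_aux (hιc : Continuous ι) {g : GaugeConfig d L G → ℝ}
    (hg : Continuous g) :
    Integrable (fun U => ∫ σ, g (abelianTwist ι σ U) ∂(Measure.pi fun _ : Edge d L => haarProbability Γ))
      (Measure.pi fun _ : Edge d L => haarProbability G) := by
  set F : GaugeConfig d L G × GaugeConfig d L Γ → ℝ := fun p => g (abelianTwist ι p.2 p.1) with hF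
  have hFc : Continuous F := hg.comp (continuous_abelianTwist_pair ι hιc)
  have hFi : Integrable F ((Measure.pi fun _ : Edge d L => haarProbability G).prod
      (Measure.pi fun _ : Edge d L => haarProbability Γ)) :=
    integrable_of_continuous_compactSpace _ hFc
  exact hFi.integral_prod_left

end Helpers

/-! ### The comparison theorem for `Γ = ℤ_n`, every `n ≥ 1` -/

section Zn

variable {d L N : ℕ} [NeZero L] {G : Type*} [Group G] [TopologicalSpace G] [IsTopologicalGroup G]
  [CompactSpace G] [MeasurableSpace G] [BorelSpace G] [SecondCountableTopology G]
  (ρ : G →* Matrix (Fin N) (Fin N) ℂ)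

/-- **`ℤ_n`-CENTRE DOMINATION OF WILSON LOOPS, EVERY `n ≥ 1`** (Fröhlich 1979; Grosse 1988 (4.134)
with `Γ = ℤ_n`). Let `G` be a compact second-countable group, `ρ` a continuous representation on
`ℂ^N` with unitary values, `ι : ℤ_n → G` a homomorphism into the centre on which `ρ` is scalar,
`ρ(ι(z)) = z · 1`, `β ≥ 0`, `(ℤ/Lℤ)^d` a torus. Then `|⟨W_{R×T}⟩_{G,ρ,β,L}| ≤ ⟨W_{R×T}⟩_{ℤ_n, Nβ, L}`.
Proof as in the tree's odd case (averaged Haar invariance; in the background `U` the `σ`-system is the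
`ℤ_n` theory with couplings `β|tr ρ(U_p)| ≤ Nβ` and phases), with the Messager–Miracle-Solé–Pfister and
Ginibre inequalities supplied through the square-root extension `ℤ_n^E ↪ ℤ_{2n}^E`
(`abs_phasedGinibreExpect_re_mul_le_of_le_of_sqrtExt`). [cite: Grosse1988, §4.2.4 eq. (4.134)] [cite: Frohlich1979ZN, title theorem] -/
theorem abs_wilsonExpectation_wilsonLoop_le_zn_of_neZero {n : ℕ} [NeZero n]
    (ι : ↥(rootsOfUnityCircle n) →* G) (hρ : Continuous ρ)
    (hρu : ∀ g, ρ g ∈ Matrix.unitaryGroup (Fin N) ℂ) (hι : ∀ z, ι z ∈ Subgroup.center G)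
    (hρι : ∀ z, ρ (ι z) = (((z : Circle) : ℂ)) • (1 : Matrix (Fin N) (Fin N) ℂ)) {β : ℝ} (hβ : 0 ≤ β)
    (x : Site d L) (i j : Fin d) (R T : ℕ) :
    |wilsonExpectation ρ β (wilsonLoop ρ x i j R T)| ≤
      wilsonExpectation (L := L) (znRep n) ((N : ℝ) * β) (wilsonLoop (znRep n) x i j R T) := by
  have hιc : Continuous ι := continuous_of_discreteTopology
  have hρι' : ∀ z, ρ (ι z) = ((znIncl n z : Circle) : ℂ) • (1 : Matrix (Fin N) (Fin N) ℂ) := hρι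
  set πG : Measure (GaugeConfig d L G) := Measure.pi fun _ : Edge d L => haarProbability G with hπG
  set πΓ : Measure (GaugeConfig d L ↥(rootsOfUnityCircle n)) :=
    Measure.pi fun _ : Edge d L => haarProbability ↥(rootsOfUnityCircle n) with hπΓ
  set χ := abelianPlaquetteChars (znIncl n) d L with hχ
  set χ₀ := abelianRectChar (d := d) (L := L) (znIncl n) x i j R T with hχ₀
  set c : ℝ := wilsonExpectation (L := L) (znRep n) ((N : ℝ) * β) (wilsonLoop (znRep n) x i j R T)
    with hc
  have hNβ : 0 ≤ (N : ℝ) * β := by positivity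
  have hcE : c = ginibreExpect πΓ χ (fun _ => (N : ℝ) * β) (reChar χ₀) := by
    rw [hc, ← charRep_znIncl]
    exact wilsonExpectation_charRep_eq_ginibreExpect (znIncl n) _ x i j R T
  have hc0 : 0 ≤ c := zn_wilsonExpectation_wilsonLoop_nonneg_of_neZero hNβ x i j R T
  -- the square-root extension `ℤ_n^E ↪ ℤ_{2n}^E`
  have h2 := rootsOfUnityCircle_le_two_mul n
  set jE : GaugeConfig d L ↥(rootsOfUnityCircle n) →* GaugeConfig d L ↥(rootsOfUnityCircle (2 * n)) :=
    MonoidHom.compLeft (Subgroup.inclusion h2) (Edge d L) with hjE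
  have hjE_inj : Function.Injective jE := (Subgroup.inclusion_injective h2).comp_left
  have hjE_sq : ∀ σ, ∃ s, s * s = jE σ :=
    GinibreSqrtExt.exists_mul_self_eq_compLeft _ (exists_mul_self_eq_inclusion_rootsOfUnityCircle n)
  set X : GaugeConfig d L G → ℝ := wilsonLoop ρ x i j R T with hX
  set w : GaugeConfig d L G → ℝ := fun U => Real.exp (-β * wilsonAction ρ U) with hw
  have hZpos : 0 < ∫ U, w U ∂πG := integral_exp_neg_mul_wilsonAction_pos ρ hρ β
  rw [wilsonExpectation_eq_integral_div ρ hρ β X]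
  change |(∫ U, X U * w U ∂πG) / ∫ U, w U ∂πG| ≤ c
  rw [abs_div, abs_of_pos hZpos, div_le_iff₀ hZpos]
  -- continuity of the integrands
  have hXc : Continuous X := continuous_wilsonLoop ρ hρ x i j R T
  have hwc : Continuous w :=
    Real.continuous_exp.comp (continuous_const.mul (continuous_wilsonAction ρ hρ))
  have hXwc : Continuous fun U => X U * w U := hXc.mul hwc
  -- averaged Haar invariance for the numerator and the partition function
  rw [integral_eq_integral_integral_abelianTwist ι hιc hXwc,
    integral_eq_integral_integral_abelianTwist ι hιc hwc, ← integral_const_mul]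
  -- the background system
  set e₀ : ℝ := Real.exp (-β * ((N : ℝ) * Fintype.card (Plaquette d L))) with he₀
  set J : GaugeConfig d L G → Plaquette d L → ℝ := bgCoupling ρ β with hJ
  set u : GaugeConfig d L G → Plaquette d L → Circle := bgPhase ρ with hu
  set t : GaugeConfig d L G → ℂ := fun U => (ρ (rectangleHolonomy U x i j R T)).trace with ht
  set Z : GaugeConfig d L G → ℝ := fun U => ∫ σ, phasedGinibreWeight χ (J U) (u U) σ ∂πΓ with hZ
  have hZU : ∀ U, 0 < Z U := fun U => integral_phasedGinibreWeight_pos πΓ χ (J U) (u U)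
  have hw_tw : ∀ U σ, w (abelianTwist ι σ U) = e₀ * phasedGinibreWeight χ (J U) (u U) σ := fun U σ =>
    exp_neg_mul_wilsonAction_abelianTwist hι hρι' β σ U
  have hX_tw : ∀ U σ, X (abelianTwist ι σ U) = (N : ℝ)⁻¹ * (t U * ((χ₀ σ : Circle) : ℂ)).re :=
    fun U σ => wilsonLoop_abelianTwist hι hρι' σ x i j R T U
  have hinnerB : ∀ U, ∫ σ, w (abelianTwist ι σ U) ∂πΓ = e₀ * Z U := fun U => by
    simp_rw [hw_tw]; exact integral_const_mul _ _
  have hinnerA : ∀ U, ∫ σ, X (abelianTwist ι σ U) * w (abelianTwist ι σ U) ∂πΓ =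
      ((N : ℝ)⁻¹ * e₀) *
        (phasedGinibreExpect πΓ χ (J U) (u U) (fun σ => (t U * ((χ₀ σ : Circle) : ℂ)).re) * Z U) := by
    intro U
    have e : ∀ σ, X (abelianTwist ι σ U) * w (abelianTwist ι σ U) =
        ((N : ℝ)⁻¹ * e₀) * ((t U * ((χ₀ σ : Circle) : ℂ)).re * phasedGinibreWeight χ (J U) (u U) σ) :=
      fun σ => by rw [hX_tw, hw_tw]; ring
    simp_rw [e]
    rw [integral_const_mul, phasedGinibreExpect, div_mul_cancel₀ _ (hZU U).ne']
  -- the pointwise bound (MMP + Ginibre through the square-root extension)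
  have hpt : ∀ U, |∫ σ, X (abelianTwist ι σ U) * w (abelianTwist ι σ U) ∂πΓ| ≤
      c * ∫ σ, w (abelianTwist ι σ U) ∂πΓ := by
    intro U
    rw [hinnerA, hinnerB]
    have hE := GinibreSqrtExt.abs_phasedGinibreExpect_re_mul_le_of_le_of_sqrtExt πΓ jE hjE_inj hjE_sq
      χ (abelianPlaquetteChars (znIncl (2 * n)) d L) (fun _ _ => rfl)
      (J := J U) (J' := fun _ => (N : ℝ) * β) (fun p => bgCoupling_nonneg hβ U p)
      (fun p => bgCoupling_le hρu hβ U p) (u U) (t U) χ₀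
      (abelianRectChar (znIncl (2 * n)) x i j R T) (fun _ => rfl)
    rw [← hcE] at hE
    have htN : ‖t U‖ ≤ N := norm_trace_le_of_mem_unitaryGroup_aux (hρu _)
    have hNN : (N : ℝ)⁻¹ * N ≤ 1 := by
      rcases Nat.eq_zero_or_pos N with h | h
      · simp [h]
      · rw [inv_mul_cancel₀ (by positivity)]
    have he₀ : 0 < e₀ := Real.exp_pos _
    have hZ0 := hZU U
    rw [abs_mul, abs_mul, abs_mul, abs_of_pos he₀, abs_of_nonneg (by positivity : (0 : ℝ) ≤ (N : ℝ)⁻¹),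
      abs_of_pos hZ0]
    calc (N : ℝ)⁻¹ * e₀ * (|phasedGinibreExpect πΓ χ (J U) (u U)
            (fun σ => (t U * ((χ₀ σ : Circle) : ℂ)).re)| * Z U)
        ≤ (N : ℝ)⁻¹ * e₀ * ((‖t U‖ * c) * Z U) := by gcongr
      _ ≤ (N : ℝ)⁻¹ * e₀ * (((N : ℝ) * c) * Z U) := by gcongr
      _ = ((N : ℝ)⁻¹ * N) * (c * (e₀ * Z U)) := by ring
      _ ≤ 1 * (c * (e₀ * Z U)) := by gcongr
      _ = c * (e₀ * Z U) := one_mul _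
  -- integrate the pointwise bound
  have hintB := (integrable_integral_abelianTwist_aux ι hιc hwc).const_mul c
  refine (abs_integral_le_integral_abs).trans
    (integral_mono_of_nonneg (ae_of_all _ fun U => abs_nonneg _) hintB (ae_of_all _ fun U => hpt U))

omit [NeZero L] in
/-- **Confinement is inherited from the centre `ℤ_n`, every `n ≥ 1`** (Fröhlich 1979, title claim;
Grosse 1988 after (4.134)): a volume-uniform area law of the `ℤ_n` lattice gauge theory at coupling
`Nβ` (the tree's `HasAreaLaw`) implies the area law of the `G` theory at `β`. HONEST LABEL: the `ℤ_n`
theory deconfines at weak coupling in `d = 3` and `d = 4` (Montvay–Münster p. 164), so this transfers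
confinement at strong coupling only. [cite: Grosse1988, §4.2.4 (text after eq. (4.134))] [cite: MontvayMunster1994, §3.7 (PDF p. 164)] -/
theorem hasAreaLaw_of_zn_of_neZero {n : ℕ} [NeZero n] (ι : ↥(rootsOfUnityCircle n) →* G)
    (hρ : Continuous ρ) (hρu : ∀ g, ρ g ∈ Matrix.unitaryGroup (Fin N) ℂ)
    (hι : ∀ z, ι z ∈ Subgroup.center G)
    (hρι : ∀ z, ρ (ι z) = (((z : Circle) : ℂ)) • (1 : Matrix (Fin N) (Fin N) ℂ)) {β : ℝ} (hβ : 0 ≤ β)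
    (hZn : HasAreaLaw d (znRep n) ((N : ℝ) * β)) : HasAreaLaw d ρ β := by
  obtain ⟨C, c, hc, hA⟩ := hZn
  refine ⟨C, c, hc, fun L _ x i j R T hij hR hT hRL hTL => ?_⟩
  exact (abs_wilsonExpectation_wilsonLoop_le_zn_of_neZero ρ ι hρ hρu hι hρι hβ x i j R T).trans
    ((le_abs_self _).trans (hA L x i j R T hij hR hT hRL hTL))

end Zn

/-! ### `G = SU(N)`, `ℤ_n ∋ z ↦ z·1` for every `n ∣ N`; the full centre `ℤ_N`, every `N` -/

section SUN

variable {d L : ℕ}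

/-- `SU(N) ⊆ M_N(ℂ)` is second countable. [folklore] -/
private theorem secondCountableTopology_specialUnitaryGroup_aux {N : ℕ} :
    SecondCountableTopology (Matrix.specialUnitaryGroup (Fin N) ℂ) := by
  haveI : SecondCountableTopology (Matrix (Fin N) (Fin N) ℂ) :=
    inferInstanceAs (SecondCountableTopology (Fin N → Fin N → ℂ))
  exact TopologicalSpace.Subtype.secondCountableTopology (α := Matrix (Fin N) (Fin N) ℂ) _

/-- **`SU(N)` Wilson loops are dominated by `ℤ_n` Wilson loops at coupling `Nβ` for EVERY `n ∣ N`,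
`n ≥ 1`** (Fröhlich 1979; Grosse 1988 (4.134) in the tree's normalisation `W = (1/N) Re tr`): for the
fundamental representation of `SU(N)`, `β ≥ 0` and every torus,
`|⟨W_{R×T}⟩_{SU(N),β,L}| ≤ ⟨W_{R×T}⟩_{ℤ_n, Nβ, L}`. (Odd `n`: the tree's
`specialUnitaryGroup_abs_wilsonExpectation_wilsonLoop_le_zn`.) [cite: Grosse1988, §4.2.4 eq. (4.134)] [cite: Frohlich1979ZN, title theorem] -/
theorem specialUnitaryGroup_abs_wilsonExpectation_wilsonLoop_le_zn_of_neZero [NeZero L] {n N : ℕ}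
    [NeZero n] (hnN : n ∣ N) {β : ℝ} (hβ : 0 ≤ β) (x : Site d L) (i j : Fin d) (R T : ℕ) :
    |wilsonExpectation (fundamentalRep (Fin N)) β (wilsonLoop (fundamentalRep (Fin N)) x i j R T)| ≤
      wilsonExpectation (L := L) (znRep n) ((N : ℝ) * β) (wilsonLoop (znRep n) x i j R T) := by
  haveI := secondCountableTopology_specialUnitaryGroup_aux (N := N)
  exact abs_wilsonExpectation_wilsonLoop_le_zn_of_neZero (fundamentalRep (Fin N)) (znScalarSU n N hnN)
    (continuous_fundamentalRep (Fin N)) fundamentalRep_mem_unitaryGroup (znScalarSU_mem_center hnN)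
    (fun z => rfl) hβ x i j R T

/-- **`SU(N)` confines whenever the `ℤ_n` theory at coupling `Nβ` confines**, every `n ∣ N`, `n ≥ 1`
(Fröhlich 1979, title claim), in the tree's `HasAreaLaw` currency. HONEST LABEL: content at strong
coupling only. [cite: Grosse1988, §4.2.4 (text after eq. (4.134))] [cite: MontvayMunster1994, §3.7 (PDF p. 164)] -/
theorem specialUnitaryGroup_hasAreaLaw_of_zn_of_neZero {n N : ℕ} [NeZero n] (hnN : n ∣ N) {β : ℝ}
    (hβ : 0 ≤ β) (hZn : HasAreaLaw d (znRep n) ((N : ℝ) * β)) :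
    HasAreaLaw d (fundamentalRep (Fin N)) β := by
  haveI := secondCountableTopology_specialUnitaryGroup_aux (N := N)
  exact hasAreaLaw_of_zn_of_neZero (fundamentalRep (Fin N)) (znScalarSU n N hnN)
    (continuous_fundamentalRep (Fin N)) fundamentalRep_mem_unitaryGroup (znScalarSU_mem_center hnN)
    (fun z => rfl) hβ hZn

/-- **`SU(N)` Wilson loops are dominated by the Wilson loops of its FULL CENTRE `ℤ_N` at coupling
`Nβ`, for every `N ≥ 1`** (Fröhlich 1979 / Grosse (4.134) with `Γ = Z(SU(N)) = ℤ_N`; for even `N` only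
the `ℤ₂ ⊂ ℤ_N` comparison was in the tree): `|⟨W_{R×T}⟩_{SU(N),β,L}| ≤ ⟨W_{R×T}⟩_{ℤ_N, Nβ, L}`.
[cite: Grosse1988, §4.2.4 eq. (4.134)] [cite: Frohlich1979ZN, title theorem] -/
theorem suN_abs_wilsonExpectation_wilsonLoop_le_zN [NeZero L] {N : ℕ} [NeZero N] {β : ℝ} (hβ : 0 ≤ β)
    (x : Site d L) (i j : Fin d) (R T : ℕ) :
    |wilsonExpectation (fundamentalRep (Fin N)) β (wilsonLoop (fundamentalRep (Fin N)) x i j R T)| ≤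
      wilsonExpectation (L := L) (znRep N) ((N : ℝ) * β) (wilsonLoop (znRep N) x i j R T) :=
  specialUnitaryGroup_abs_wilsonExpectation_wilsonLoop_le_zn_of_neZero (dvd_refl N) hβ x i j R T

/-- `SU(N)` confinement is inherited from its full centre `ℤ_N`, every `N ≥ 1`:
`HasAreaLaw d (znRep N) (Nβ) → HasAreaLaw d SU(N)_fund β` for `β ≥ 0`. HONEST LABEL: content at strong
coupling only. [cite: Grosse1988, §4.2.4 (text after eq. (4.134))] -/
theorem suN_hasAreaLaw_of_zN {N : ℕ} [NeZero N] {β : ℝ} (hβ : 0 ≤ β)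
    (hZN : HasAreaLaw d (znRep N) ((N : ℝ) * β)) : HasAreaLaw d (fundamentalRep (Fin N)) β :=
  specialUnitaryGroup_hasAreaLaw_of_zn_of_neZero (dvd_refl N) hβ hZN

/-- **`SU(4) ⊇ ℤ_4`** (an even case not covered by the odd-`n` theorem; the tree had only
`SU(4) ⊇ ℤ₂`): `|⟨¼ Re tr U_{∂R×T}⟩_{SU(4),β,L}| ≤ ⟨W_{R×T}⟩_{ℤ_4, 4β, L}` for every `β ≥ 0`.
[cite: Grosse1988, §4.2.4 eq. (4.134)] [cite: Frohlich1979ZN, title theorem] -/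
theorem su4_abs_wilsonExpectation_wilsonLoop_le_z4 [NeZero L] {β : ℝ} (hβ : 0 ≤ β) (x : Site d L)
    (i j : Fin d) (R T : ℕ) :
    |wilsonExpectation (fundamentalRep (Fin 4)) β (wilsonLoop (fundamentalRep (Fin 4)) x i j R T)| ≤
      wilsonExpectation (L := L) (znRep 4) (4 * β) (wilsonLoop (znRep 4) x i j R T) := by
  have h := suN_abs_wilsonExpectation_wilsonLoop_le_zN (d := d) (L := L) (N := 4) hβ x i j R T
  simpa using h

/-- **`SU(2) ⊇ ℤ₂` in the `znRep 2` currency**: `|⟨½ Re tr U_{∂R×T}⟩_{SU(2),β,L}| ≤ ⟨W_{R×T}⟩_{ℤ_2, 2β, L}`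
(Grosse's printed case (4.134); cf. `su2_abs_wilsonExpectation_wilsonLoop_le_z2` of
`CentreDominatedWilsonLoops.lean`, stated with the sign subgroup). [cite: Grosse1988, §4.2.4 eq. (4.134)] -/
theorem su2_abs_wilsonExpectation_wilsonLoop_le_znRep_two [NeZero L] {β : ℝ} (hβ : 0 ≤ β)
    (x : Site d L) (i j : Fin d) (R T : ℕ) :
    |wilsonExpectation (fundamentalRep (Fin 2)) β (wilsonLoop (fundamentalRep (Fin 2)) x i j R T)| ≤
      wilsonExpectation (L := L) (znRep 2) (2 * β) (wilsonLoop (znRep 2) x i j R T) := by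
  have h := suN_abs_wilsonExpectation_wilsonLoop_le_zN (d := d) (L := L) (N := 2) hβ x i j R T
  simpa using h

end SUN

/-! ### Centre-blind perturbations of the Wilson weight (Fröhlich's lattice-Higgs setting), every `n` -/

section Perturbed

variable {d L N : ℕ} [NeZero L] {G : Type*} [Group G] [TopologicalSpace G] [IsTopologicalGroup G]
  [CompactSpace G] [MeasurableSpace G] [BorelSpace G] [SecondCountableTopology G]
  (ρ : G →* Matrix (Fin N) (Fin N) ℂ)

/-- **`ℤ_n`-CENTRE DOMINATION SURVIVES EVERY CENTRE-BLIND PERTURBATION OF THE WILSON WEIGHT, EVERY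
`n ≥ 1`** (Fröhlich 1979, title theorem «Confinement in `ℤ_n` lattice gauge theories implies
confinement in `SU(n)` lattice Higgs theories»; Grosse 1988 (4.131)–(4.134)). Setting as in
`abs_wilsonExpectation_wilsonLoop_le_zn_of_neZero`, and let `F ≥ 0` be any continuous weight on
configurations which is BLIND to the twists, `F(ι(σ)·U) = F(U)` for all `σ ∈ ℤ_n^E` (e.g. the weight
obtained by integrating out Higgs / matter fields in a representation trivial on `ι(ℤ_n)`). Then
`|∫ W_{R×T}(U) F(U) e^{−β S(U)} dU| ≤ ⟨W_{R×T}⟩_{ℤ_n, Nβ, L} · ∫ F(U) e^{−β S(U)} dU` (odd `n`: the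
tree's `abs_integral_wilsonLoop_mul_le_of_twistInvariant` with `Γ = ℤ_n`). [cite: Frohlich1979ZN, title theorem (lattice Higgs theories)] [cite: Grosse1988, §4.2.4 eqs. (4.131)–(4.134)] -/
theorem abs_integral_wilsonLoop_mul_le_of_twistInvariant_zn_of_neZero {n : ℕ} [NeZero n]
    (ι : ↥(rootsOfUnityCircle n) →* G) (hρ : Continuous ρ)
    (hρu : ∀ g, ρ g ∈ Matrix.unitaryGroup (Fin N) ℂ) (hι : ∀ z, ι z ∈ Subgroup.center G)
    (hρι : ∀ z, ρ (ι z) = (((z : Circle) : ℂ)) • (1 : Matrix (Fin N) (Fin N) ℂ)) {β : ℝ} (hβ : 0 ≤ β)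
    {F : GaugeConfig d L G → ℝ} (hFc : Continuous F) (hF0 : ∀ U, 0 ≤ F U)
    (hFι : ∀ σ U, F (abelianTwist ι σ U) = F U) (x : Site d L) (i j : Fin d) (R T : ℕ) :
    |∫ U, wilsonLoop ρ x i j R T U * (F U * Real.exp (-β * wilsonAction ρ U))
        ∂(Measure.pi fun _ : Edge d L => haarProbability G)| ≤
      wilsonExpectation (L := L) (znRep n) ((N : ℝ) * β) (wilsonLoop (znRep n) x i j R T) *
        ∫ U, F U * Real.exp (-β * wilsonAction ρ U) ∂(Measure.pi fun _ : Edge d L => haarProbability G) := by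
  have hιc : Continuous ι := continuous_of_discreteTopology
  have hρι' : ∀ z, ρ (ι z) = ((znIncl n z : Circle) : ℂ) • (1 : Matrix (Fin N) (Fin N) ℂ) := hρι
  set πG : Measure (GaugeConfig d L G) := Measure.pi fun _ : Edge d L => haarProbability G with hπG
  set πΓ : Measure (GaugeConfig d L ↥(rootsOfUnityCircle n)) :=
    Measure.pi fun _ : Edge d L => haarProbability ↥(rootsOfUnityCircle n) with hπΓ
  set χ := abelianPlaquetteChars (znIncl n) d L with hχ
  set χ₀ := abelianRectChar (d := d) (L := L) (znIncl n) x i j R T with hχ₀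
  set c : ℝ := wilsonExpectation (L := L) (znRep n) ((N : ℝ) * β) (wilsonLoop (znRep n) x i j R T)
    with hc
  have hNβ : 0 ≤ (N : ℝ) * β := by positivity
  have hcE : c = ginibreExpect πΓ χ (fun _ => (N : ℝ) * β) (reChar χ₀) := by
    rw [hc, ← charRep_znIncl]
    exact wilsonExpectation_charRep_eq_ginibreExpect (znIncl n) _ x i j R T
  have hc0 : 0 ≤ c := zn_wilsonExpectation_wilsonLoop_nonneg_of_neZero hNβ x i j R T
  -- the square-root extension `ℤ_n^E ↪ ℤ_{2n}^E`
  have h2 := rootsOfUnityCircle_le_two_mul n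
  set jE : GaugeConfig d L ↥(rootsOfUnityCircle n) →* GaugeConfig d L ↥(rootsOfUnityCircle (2 * n)) :=
    MonoidHom.compLeft (Subgroup.inclusion h2) (Edge d L) with hjE
  have hjE_inj : Function.Injective jE := (Subgroup.inclusion_injective h2).comp_left
  have hjE_sq : ∀ σ, ∃ s, s * s = jE σ :=
    GinibreSqrtExt.exists_mul_self_eq_compLeft _ (exists_mul_self_eq_inclusion_rootsOfUnityCircle n)
  set X : GaugeConfig d L G → ℝ := wilsonLoop ρ x i j R T with hX
  set w : GaugeConfig d L G → ℝ := fun U => F U * Real.exp (-β * wilsonAction ρ U) with hw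
  change |∫ U, X U * w U ∂πG| ≤ c * ∫ U, w U ∂πG
  -- continuity of the integrands
  have hXc : Continuous X := continuous_wilsonLoop ρ hρ x i j R T
  have hwc : Continuous w :=
    hFc.mul (Real.continuous_exp.comp (continuous_const.mul (continuous_wilsonAction ρ hρ)))
  have hXwc : Continuous fun U => X U * w U := hXc.mul hwc
  -- averaged Haar invariance for the numerator and the normaliser
  rw [integral_eq_integral_integral_abelianTwist ι hιc hXwc,
    integral_eq_integral_integral_abelianTwist ι hιc hwc, ← integral_const_mul]
  -- the background system
  set e₀ : ℝ := Real.exp (-β * ((N : ℝ) * Fintype.card (Plaquette d L))) with he₀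
  set J : GaugeConfig d L G → Plaquette d L → ℝ := bgCoupling ρ β with hJ
  set u : GaugeConfig d L G → Plaquette d L → Circle := bgPhase ρ with hu
  set t : GaugeConfig d L G → ℂ := fun U => (ρ (rectangleHolonomy U x i j R T)).trace with ht
  set Z : GaugeConfig d L G → ℝ := fun U => ∫ σ, phasedGinibreWeight χ (J U) (u U) σ ∂πΓ with hZ
  have hZU : ∀ U, 0 < Z U := fun U => integral_phasedGinibreWeight_pos πΓ χ (J U) (u U)
  have hw_tw : ∀ U σ, w (abelianTwist ι σ U) = F U * (e₀ * phasedGinibreWeight χ (J U) (u U) σ) :=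
    fun U σ => by
      show F (abelianTwist ι σ U) * Real.exp (-β * wilsonAction ρ (abelianTwist ι σ U)) = _
      rw [hFι, exp_neg_mul_wilsonAction_abelianTwist hι hρι' β σ U]
  have hX_tw : ∀ U σ, X (abelianTwist ι σ U) = (N : ℝ)⁻¹ * (t U * ((χ₀ σ : Circle) : ℂ)).re :=
    fun U σ => wilsonLoop_abelianTwist hι hρι' σ x i j R T U
  have hinnerB : ∀ U, ∫ σ, w (abelianTwist ι σ U) ∂πΓ = F U * (e₀ * Z U) := fun U => by
    simp_rw [hw_tw]; rw [integral_const_mul, integral_const_mul]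
  have hinnerA : ∀ U, ∫ σ, X (abelianTwist ι σ U) * w (abelianTwist ι σ U) ∂πΓ =
      F U * (((N : ℝ)⁻¹ * e₀) *
        (phasedGinibreExpect πΓ χ (J U) (u U) (fun σ => (t U * ((χ₀ σ : Circle) : ℂ)).re) * Z U)) := by
    intro U
    have e : ∀ σ, X (abelianTwist ι σ U) * w (abelianTwist ι σ U) =
        (F U * ((N : ℝ)⁻¹ * e₀)) *
          ((t U * ((χ₀ σ : Circle) : ℂ)).re * phasedGinibreWeight χ (J U) (u U) σ) :=
      fun σ => by rw [hX_tw, hw_tw]; ring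
    simp_rw [e]
    rw [integral_const_mul, phasedGinibreExpect, div_mul_cancel₀ _ (hZU U).ne', mul_assoc]
  -- the pointwise bound (MMP + Ginibre through the square-root extension), blind to `F`
  have key : ∀ U, |((N : ℝ)⁻¹ * e₀) *
      (phasedGinibreExpect πΓ χ (J U) (u U) (fun σ => (t U * ((χ₀ σ : Circle) : ℂ)).re) * Z U)| ≤
        c * (e₀ * Z U) := by
    intro U
    have hE := GinibreSqrtExt.abs_phasedGinibreExpect_re_mul_le_of_le_of_sqrtExt πΓ jE hjE_inj hjE_sq
      χ (abelianPlaquetteChars (znIncl (2 * n)) d L) (fun _ _ => rfl)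
      (J := J U) (J' := fun _ => (N : ℝ) * β) (fun p => bgCoupling_nonneg hβ U p)
      (fun p => bgCoupling_le hρu hβ U p) (u U) (t U) χ₀
      (abelianRectChar (znIncl (2 * n)) x i j R T) (fun _ => rfl)
    rw [← hcE] at hE
    have htN : ‖t U‖ ≤ N := norm_trace_le_of_mem_unitaryGroup_aux (hρu _)
    have hNN : (N : ℝ)⁻¹ * N ≤ 1 := by
      rcases Nat.eq_zero_or_pos N with h | h
      · simp [h]
      · rw [inv_mul_cancel₀ (by positivity)]
    have he₀ : 0 < e₀ := Real.exp_pos _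
    have hZ0 := hZU U
    rw [abs_mul, abs_mul, abs_mul, abs_of_pos he₀, abs_of_nonneg (by positivity : (0 : ℝ) ≤ (N : ℝ)⁻¹),
      abs_of_pos hZ0]
    calc (N : ℝ)⁻¹ * e₀ * (|phasedGinibreExpect πΓ χ (J U) (u U)
            (fun σ => (t U * ((χ₀ σ : Circle) : ℂ)).re)| * Z U)
        ≤ (N : ℝ)⁻¹ * e₀ * ((‖t U‖ * c) * Z U) := by gcongr
      _ ≤ (N : ℝ)⁻¹ * e₀ * (((N : ℝ) * c) * Z U) := by gcongr
      _ = ((N : ℝ)⁻¹ * N) * (c * (e₀ * Z U)) := by ring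
      _ ≤ 1 * (c * (e₀ * Z U)) := by gcongr
      _ = c * (e₀ * Z U) := one_mul _
  have hpt : ∀ U, |∫ σ, X (abelianTwist ι σ U) * w (abelianTwist ι σ U) ∂πΓ| ≤
      c * ∫ σ, w (abelianTwist ι σ U) ∂πΓ := by
    intro U
    rw [hinnerA, hinnerB, abs_mul, abs_of_nonneg (hF0 U), mul_left_comm c (F U)]
    exact mul_le_mul_of_nonneg_left (key U) (hF0 U)
  -- integrate the pointwise bound
  have hintB := (integrable_integral_abelianTwist_aux ι hιc hwc).const_mul c
  refine (abs_integral_le_integral_abs).trans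
    (integral_mono_of_nonneg (ae_of_all _ fun U => abs_nonneg _) hintB (ae_of_all _ fun U => hpt U))

/-- **Normalised form, every `n ≥ 1`**: for a centre-blind continuous weight `F ≥ 0` with positive
normaliser, the Wilson loop of the PERTURBED theory `dμ ∝ F e^{−βS} dU` obeys
`|⟨W_{R×T}⟩_{G,ρ,β,F,L}| ≤ ⟨W_{R×T}⟩_{ℤ_n, Nβ, L}` (odd `n`: the tree's `abs_perturbedWilsonLoop_le_zn`).
[cite: Frohlich1979ZN, title theorem (lattice Higgs theories)] [cite: Grosse1988, §4.2.4 eq. (4.134)] -/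
theorem abs_perturbedWilsonLoop_le_zn_of_neZero {n : ℕ} [NeZero n] (ι : ↥(rootsOfUnityCircle n) →* G)
    (hρ : Continuous ρ) (hρu : ∀ g, ρ g ∈ Matrix.unitaryGroup (Fin N) ℂ)
    (hι : ∀ z, ι z ∈ Subgroup.center G)
    (hρι : ∀ z, ρ (ι z) = (((z : Circle) : ℂ)) • (1 : Matrix (Fin N) (Fin N) ℂ)) {β : ℝ} (hβ : 0 ≤ β)
    {F : GaugeConfig d L G → ℝ} (hFc : Continuous F) (hF0 : ∀ U, 0 ≤ F U)
    (hFι : ∀ σ U, F (abelianTwist ι σ U) = F U)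
    (hFZ : 0 < ∫ U, F U * Real.exp (-β * wilsonAction ρ U) ∂(Measure.pi fun _ : Edge d L => haarProbability G))
    (x : Site d L) (i j : Fin d) (R T : ℕ) :
    |(∫ U, wilsonLoop ρ x i j R T U * (F U * Real.exp (-β * wilsonAction ρ U))
        ∂(Measure.pi fun _ : Edge d L => haarProbability G)) /
      ∫ U, F U * Real.exp (-β * wilsonAction ρ U) ∂(Measure.pi fun _ : Edge d L => haarProbability G)| ≤
      wilsonExpectation (L := L) (znRep n) ((N : ℝ) * β) (wilsonLoop (znRep n) x i j R T) := by
  rw [abs_div, abs_of_pos hFZ, div_le_iff₀ hFZ]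
  exact abs_integral_wilsonLoop_mul_le_of_twistInvariant_zn_of_neZero ρ ι hρ hρu hι hρι hβ hFc hF0 hFι
    x i j R T

/-- **Fröhlich's title theorem for the full centre, every `N ≥ 1`: `SU(N)` lattice gauge theory with
any centre-blind matter weight `F ≥ 0` is dominated by the `ℤ_N` theory at `Nβ`**:
`|⟨W_{R×T}⟩_{SU(N),β,F,L}| ≤ ⟨W_{R×T}⟩_{ℤ_N, Nβ, L}` — here `F(z·U) = F(U)` for all `z ∈ ℤ_N^E`
(e.g. adjoint Higgs fields, or any matter in a representation of `SU(N)/ℤ_N`). HONEST LABEL: content at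
strong coupling only. [cite: Frohlich1979ZN, title theorem (lattice Higgs theories)] [cite: Grosse1988, §4.2.4 eq. (4.134)] -/
theorem suN_abs_perturbedWilsonLoop_le_zN {N : ℕ} [NeZero N] {β : ℝ} (hβ : 0 ≤ β)
    {F : GaugeConfig d L (Matrix.specialUnitaryGroup (Fin N) ℂ) → ℝ} (hFc : Continuous F)
    (hF0 : ∀ U, 0 ≤ F U) (hFι : ∀ σ U, F (abelianTwist (znScalarSU N N (dvd_refl N)) σ U) = F U)
    (hFZ : 0 < ∫ U, F U * Real.exp (-β * wilsonAction (fundamentalRep (Fin N)) U)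
      ∂(Measure.pi fun _ : Edge d L => haarProbability (Matrix.specialUnitaryGroup (Fin N) ℂ)))
    (x : Site d L) (i j : Fin d) (R T : ℕ) :
    |(∫ U, wilsonLoop (fundamentalRep (Fin N)) x i j R T U *
          (F U * Real.exp (-β * wilsonAction (fundamentalRep (Fin N)) U))
        ∂(Measure.pi fun _ : Edge d L => haarProbability (Matrix.specialUnitaryGroup (Fin N) ℂ))) /
      ∫ U, F U * Real.exp (-β * wilsonAction (fundamentalRep (Fin N)) U)
        ∂(Measure.pi fun _ : Edge d L => haarProbability (Matrix.specialUnitaryGroup (Fin N) ℂ))| ≤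
      wilsonExpectation (L := L) (znRep N) ((N : ℝ) * β) (wilsonLoop (znRep N) x i j R T) := by
  haveI := secondCountableTopology_specialUnitaryGroup_aux (N := N)
  exact abs_perturbedWilsonLoop_le_zn_of_neZero (fundamentalRep (Fin N)) (znScalarSU N N (dvd_refl N))
    (continuous_fundamentalRep (Fin N)) fundamentalRep_mem_unitaryGroup (znScalarSU_mem_center _)
    (fun z => rfl) hβ hFc hF0 hFι hFZ x i j R T

end Perturbed

end Literature.MathematicalPhysics.QuantumFieldTheory

end
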